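import Mathlib

/-!
# SoloBlind — the Hesse plane family on the pentagon Noether–Lefschetz cubic (s159)

Pure-algebra certificate behind THEOREM HESSE-PENT of the solo-blind programme
(`run/shared/lean/ideation/HodgeConjecture/solo-blind/work/s159/n3prime.md` §2.3).

Setting: the K3 fibres of the sextic family are six-line double planes `K(a,b,c,d)` with
`(a,b,c,d) = (2y₁³, 2y₂³, -ψ y₁y₂y₃, 2y₃³)`; the base `ℙ²_y` maps to the cubic surface
`c³ = κ a b d`, `κ = -ψ³/8`.  A line `y₃ = α y₁ + β y₂` maps into the plane
`d = α³ a + β³ b - (6αβ/ψ) c` (`line_to_plane`).  The pentagon NL cubic restricted to the plane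
`d = a + b + g c` equals `(1+g)²(1-g) c³ + 32 a b d` (`pentagonCubic_plane`), i.e. it lies in the
pencil `⟨c³, abd⟩` with `κ(g) = -32/((1+g)²(1-g))`; the pulled-back Hesse cubic
`y₁³ + y₂³ - y₃³ - (gψ/2) y₁y₂y₃` is singular iff `(gψ)³ = -216`; flatness
`ψ³ (1+g)²(1-g) = 256` together with singularity forces `(g-3)²(5g+3) = 0` (`hesse_joint`),
whence `ψ³ ∈ {1000, -8}`, `κ ∈ {-125, 1}`: the pentagon-critical points `ψ = 10` and `ψ = -2`,
where the member with `gψ = -6` splits off the line `N : y₁ + y₂ = y₃`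
(`hesse_singular_member_factor`).
-/

namespace Summit.HodgeConjecture.HodgeConjecture.Theorems

namespace SoloBlindHesseFamily

/-- A line `y₃ = α y₁ + β y₂` of the base maps into a plane of the `(a,b,c,d)`-space. -/
theorem line_to_plane (α β ψ y₁ y₂ : ℚ) (hψ : ψ ≠ 0) :
    2 * (α*y₁ + β*y₂)^3
      = α^3 * (2*y₁^3) + β^3 * (2*y₂^3) - (6*α*β/ψ) * (-ψ * y₁ * y₂ * (α*y₁ + β*y₂)) := by
  field_simp
  ring

/-- The pentagon Noether–Lefschetz cubic (the variant labelled `tan 1+ cyc 1--2+-2--3--3+`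
in `work/s159/nl159/conds159.json`; the other seven variants differ by signs of `a,b,c,d`). -/
def pentagonCubic (a b c d : ℚ) : ℚ :=
  c^3 + c^2*d - b*c^2 - a*c^2 + 2*a*c*d - a^2*c - 2*a*b*c + 2*b*c*d - b^2*c - c*d^2 - d^3
  + 3*a*d^2 + 3*b*d^2 + 26*a*b*d - 3*a^2*d - 3*b^2*d + 3*a*b^2 + 3*a^2*b + b^3 + a^3

/-- THEOREM HESSE-PENT (a): on the plane `d = a + b + g c` the pentagon cubic is in the pencil
`⟨c³, a b d⟩`. -/
theorem pentagonCubic_plane (a b c g : ℚ) :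
    pentagonCubic a b c (a + b + g*c) = (1+g)^2*(1-g) * c^3 + 32 * (a*b*(a + b + g*c)) := by
  unfold pentagonCubic
  ring

/-- Equivalently `Φ|_Π = λ(g) · (c³ - κ(g)·abd)` with `κ(g) = -32/λ(g)`, `λ(g) = (1+g)²(1-g)`. -/
theorem pentagonCubic_plane_pencil (a b c g : ℚ) (hg : (1+g)^2*(1-g) ≠ 0) :
    pentagonCubic a b c (a + b + g*c)
      = (1+g)^2*(1-g) * (c^3 - (-32/((1+g)^2*(1-g))) * (a*b*(a + b + g*c))) := by
  rw [pentagonCubic_plane]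
  obtain ⟨L, hL⟩ : ∃ L : ℚ, (1+g)^2*(1-g) = L := ⟨_, rfl⟩
  rw [hL] at hg ⊢
  have h32 : L * (-32 / L) = -32 := mul_div_cancel₀ _ hg
  calc L * c ^ 3 + 32 * (a * b * (a + b + g * c))
        = L * c ^ 3 - (L * (-32 / L)) * (a * b * (a + b + g * c)) := by rw [h32]; ring
    _ = L * (c ^ 3 - (-32 / L) * (a * b * (a + b + g * c))) := by ring

/-- THEOREM HESSE-PENT (b): flatness (`κ(g) = -ψ³/8`, i.e. `ψ³ λ(g) = 256`) and singularity of
the pulled-back Hesse cubic (`(gψ)³ = -216`) together force `(g-3)²(5g+3) = 0`. -/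
theorem hesse_joint (g ψ : ℚ) (h1 : ψ^3 * ((1+g)^2*(1-g)) = 256) (h2 : (g*ψ)^3 = -216) :
    (g-3)^2 * (5*g+3) = 0 := by
  linear_combination (-g^3/8) * h1 + ((1+g)^2*(1-g)/8) * h2

/-- The joint condition as an explicit cubic in `g`. -/
theorem hesse_joint_poly (g : ℚ) : 5*g^3 - 27*g^2 + 27*g + 27 = (g-3)^2 * (5*g+3) := by ring

/-- Its roots: `g = 3` (double) and `g = -3/5`. -/
theorem hesse_joint_roots (g : ℚ) : (g-3)^2 * (5*g+3) = 0 ↔ g = 3 ∨ g = -3/5 := by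
  constructor
  · intro h
    rcases mul_eq_zero.mp h with h | h
    · left
      have h' : g - 3 = 0 := (pow_eq_zero_iff (by norm_num)).mp h
      linarith
    · right
      linarith
  · rintro (rfl | rfl) <;> norm_num

/-- The two roots give `ψ³ = 256/λ(g) ∈ {1000, -8}` and `κ(g) = -32/λ(g) ∈ {-125, 1}`. -/
theorem hesse_roots_values :
    (256:ℚ) / ((1 + (-3/5:ℚ))^2 * (1 - (-3/5))) = 1000 ∧ (256:ℚ) / ((1 + (3:ℚ))^2 * (1 - 3)) = -8 ∧
    (-32:ℚ) / ((1 + (-3/5:ℚ))^2 * (1 - (-3/5))) = -125 ∧ (-32:ℚ) / ((1 + (3:ℚ))^2 * (1 - 3)) = 1 := by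
  norm_num

/-- In both cases `gψ = -6` (`(-3/5)·10 = 3·(-2) = -6`, consistent with `(gψ)³ = -216`), and the
Hesse member `y₁³ + y₂³ - y₃³ + 3 y₁y₂y₃` splits off the line `N : y₁ + y₂ = y₃`. -/
theorem hesse_gpsi : ((-3/5:ℚ) * 10 = -6) ∧ ((3:ℚ) * (-2) = -6) ∧ ((-6:ℚ)^3 = -216) := by norm_num

/-- The singular Hesse member at `gψ = -6` contains the line `N : y₁ + y₂ = y₃`. -/
theorem hesse_singular_member_factor (y₁ y₂ y₃ : ℚ) :
    y₁^3 + y₂^3 - y₃^3 + 3*y₁*y₂*y₃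
      = (y₁ + y₂ - y₃) * (y₁^2 + y₂^2 + y₃^2 - y₁*y₂ + y₁*y₃ + y₂*y₃) := by
  ring

end SoloBlindHesseFamily

end Summit.HodgeConjecture.HodgeConjecture.Theorems
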